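import Summits.Parity.GeneralizedHardyLittlewood.Theorems.LeeYangFibresRelativeDimOneMoebiusSplitClassSumsAux3
import Mathlib
import HarnessLib

/-!
# Route `LeeYangFibres`, crux `RelativeDimOne` (stmt-Parity-14113), line `single-moebius-split`:
# stub `stub_termClassSums` (S1-E) — the single-Möbius class sums reduced to the atom

`stub_termClassSums : ∀ k j, j ≠ 0 → ∀ η > 0, (∀ C A, HybridOneMoebius j η C A) → TermClassSumBound k j η`.
Given the atom at Möbius-dilation exponent `η` (used at `η₁ = min η 1`, `hybridOneMoebius_mono`), prime
dilation `C = 1/θ` and saving `A = k + j + 2^{k+2} + 2`, where `θ = δ_j − σ_j > 0` and `σ_j ≤ η₁ θ` by the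
staggering `(2 + 1/η) σ_j ≤ δ_j`: the classes `(d, e)` with `R_j e > 2LN` are empty
(`tcs_termClassSum_eq_zero`); every other class sum is at most `W · (2N/M₀(d,e) + 1)`,
`W = 2 log(2LN)(2S_N + 1)/((θ/2) log N)^A` (`tcs_perClass`, for `N ≥ N₀(k, L, δ, ε, Y₀)`); the moduli have
`∑ 1/M₀ ≤ 2L^{k+2}(1 + log(2LN²))^{2^{k+2}}` (`sum_inv_moduli_le` with `tcs_count_multiples`) and there are
`≤ 2L N^{1−θ}` classes (`tcs_card_pairs_le`); the closing estimate is `tcs_eventually_small`.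
(Sawin–Shusterman, arXiv:1808.04001, Cor. 6.1, transported to `ℤ`.)
-/

noncomputable section

open scoped BigOperators Classical
open Finset Filter Literature.NumberTheory.Sieve

namespace Summit.Parity.GeneralizedHardyLittlewood.Cruxes.RelativeDimOne.SingleMoebiusSplit

/-- The exponents of the line: from `(2 + 1/η) σ ≤ δ_j`, `σ ≥ 0`, `δ_j > 0`, `η > 0` one gets
`θ = δ_j − σ > 0` and `σ ≤ min(η, 1) · θ`. -/
theorem tcs_exponents {η σ δj : ℝ} (hη : 0 < η) (hσ : 0 ≤ σ) (hδj : 0 < δj)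
    (hstag : (2 + 1 / η) * σ ≤ δj) : 0 < δj - σ ∧ σ ≤ min η 1 * (δj - σ) := by
  have h1 : 0 ≤ 1 / η * σ := by positivity
  have hθ : (1 + 1 / η) * σ ≤ δj - σ := by linarith
  constructor
  · rcases hσ.lt_or_eq with hσ0 | hσ0
    · nlinarith
    · rw [← hσ0]; linarith
  · rcases le_total η 1 with h | h
    · rw [min_eq_left h]
      have h2 : η * ((1 + 1 / η) * σ) ≤ η * (δj - σ) := mul_le_mul_of_nonneg_left hθ hη.le
      have h3 : η * ((1 + 1 / η) * σ) = (η + 1) * σ := by field_simp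
      nlinarith
    · rw [min_eq_right h]
      nlinarith

/-- **S1-E — the single-Möbius class sums are negligible given the atom** (registered stub of the line
`single-moebius-split`; see the module docstring and `TermClassSumBound`). -/
theorem stub_termClassSums : ∀ (k : ℕ) (j : Fin (k + 1)), j ≠ 0 → ∀ η : ℝ, 0 < η →
    (∀ C A : ℝ, HybridOneMoebius (j : ℕ) η C A) → TermClassSumBound k j η := by
  intro k j hj η hη hH L δ hδ hstag hsum ε hε
  -- degenerate size `L = 0`: no non-degenerate system has size `≤ 0`
  rcases Nat.eq_zero_or_pos L with hL0 | hL1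
  · refine ⟨1, fun N hN Ψ hΨ hsize K _ _ => ?_⟩
    exfalso
    have h := (natAbs_le_of_affLinSize_le hN hsize j).1
    rw [hL0, Nat.le_zero, Int.natAbs_eq_zero] at h
    exact coeff_zero_ne_zero hΨ j h
  -- exponents and constants
  obtain ⟨σ, hσ⟩ : ∃ σ : ℝ, σ = ∑ i ∈ Finset.Ioi j, δ i := ⟨_, rfl⟩
  obtain ⟨θ, hθ⟩ : ∃ θ : ℝ, θ = δ j - σ := ⟨_, rfl⟩
  have hσ0 : 0 ≤ σ := by rw [hσ]; exact Finset.sum_nonneg fun i _ => (hδ i).le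
  have hstagj : (2 + 1 / η) * σ ≤ δ j := by rw [hσ]; exact hstag j
  obtain ⟨hθ0, hση⟩ := tcs_exponents hη hσ0 (hδ j) hstagj
  rw [← hθ] at hθ0 hση
  have hσ1 : σ ≤ 1 := by
    have h : ∑ i ∈ Finset.Ioi j, δ i ≤ ∑ i, δ i :=
      Finset.sum_le_sum_of_subset_of_nonneg (Finset.subset_univ _) fun i _ _ => (hδ i).le
    rw [hσ]; linarith
  set η₁ : ℝ := min η 1 with hη₁
  have hη₁0 : 0 < η₁ := lt_min hη one_pos
  have hη₁1 : η₁ ≤ 1 := min_le_right _ _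
  set C : ℝ := 1 / θ with hC
  have hC0 : 0 ≤ C := by positivity
  have hθC : 1 ≤ θ * C := by rw [hC, mul_one_div_cancel hθ0.ne']
  set s : ℕ := (j : ℕ) with hs
  set m : ℕ := 2 ^ (k + 2) with hm
  set A : ℝ := ((k + s + m + 2 : ℕ) : ℝ) with hA
  have hA0 : 0 ≤ A := Nat.cast_nonneg _
  set c : ℝ := 2 * Real.exp 5 * (4 * s * s + 9) with hc
  have hc0 : 0 ≤ c := by positivity
  have hL1r : (1 : ℝ) ≤ L := by exact_mod_cast hL1
  -- the atom at `η₁`, `L' = 4L²`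
  obtain ⟨Y₀, hY₀⟩ := hybridOneMoebius_mono (min_le_left η 1) (hH C A) (4 * L ^ 2)
  -- `N` large
  have hev := (tcs_eventually_small k s m θ ε L c hθ0 hε hL1r hc0).and
    ((tcs_eventually_le_rpow ((L : ℝ) * Y₀) hθ0).and ((tcs_eventually_le_rpow ((L : ℝ) ^ 2) hθ0).and
    ((tcs_eventually_le_rpow ((k : ℝ) * (L : ℝ) ^ C / 2) hθ0).and
    ((Filter.eventually_ge_atTop (8 * L ^ 3)).and (Filter.eventually_ge_atTop 3)))))
  obtain ⟨N₀, hN₀⟩ := Filter.eventually_atTop.mp hev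
  refine ⟨N₀, fun N hN Ψ hΨ hsize K hK hKN => ?_⟩
  obtain ⟨h1, h2, h3, h4, h5, h6⟩ := hN₀ N hN
  have h4' : (k : ℝ) * (L : ℝ) ^ C ≤ 2 * (N : ℝ) ^ θ := by linarith only [h4]
  have hN1 : 1 ≤ N := by omega
  have hN0 : (0 : ℝ) < N := by exact_mod_cast (show 0 < N by omega)
  have hN1r : (1 : ℝ) ≤ N := by exact_mod_cast hN1
  have hN3r : (3 : ℝ) ≤ N := by exact_mod_cast h6
  have hlogN : 0 < Real.log N := Real.log_pos (by linarith only [hN3r])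
  have hRj0 : 0 < (N : ℝ) ^ (δ j) := Real.rpow_pos_of_pos hN0 _
  have hRj1 : 1 ≤ (N : ℝ) ^ (δ j) := Real.one_le_rpow hN1r (hδ j).le
  -- names: the moduli of the classes, the tuple ranges, the per-class factor
  obtain ⟨Q, hQ⟩ : ∃ Q : ℕ × (Fin (k + 1) → ℕ) → Fin (k + 1) → ℕ,
      ∀ p i, Q p i = if i ∈ Finset.Ioi j then p.2 i else if i = j then p.1 else 1 :=
    ⟨_, fun _ _ => rfl⟩
  obtain ⟨M, hM⟩ : ∃ M : ℕ × (Fin (k + 1) → ℕ) → ℕ,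
      ∀ p, M p = Finset.univ.lcm (fun i => Q p i / Int.gcd ((Ψ i).coeff 0) (Q p i)) :=
    ⟨_, fun _ => rfl⟩
  set B : Fin (k + 1) → ℕ := fun i => ⌊(N : ℝ) ^ (δ i)⌋₊ with hB
  set T : Fin (k + 1) → Finset ℕ := fun i =>
    if i ∈ Finset.Ioi j then Finset.Icc 1 ⌊(N : ℝ) ^ (δ i)⌋₊ else {1} with hT
  obtain ⟨S, hS⟩ : ∃ S : ℝ, S = (2 * Real.exp 5 * ((4 * (j : ℕ) * (j : ℕ) + 9) * Real.log N)) ^ (j : ℕ) :=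
    ⟨_, rfl⟩
  obtain ⟨W, hW⟩ : ∃ W : ℝ, W = 2 * Real.log (2 * L * N) * ((2 * S + 1) / (θ / 2 * Real.log N) ^ A) :=
    ⟨_, rfl⟩
  have hS0 : 0 ≤ S := by rw [hS]; exact pow_nonneg (by positivity) _
  have hG0 : 0 ≤ Real.log (2 * L * N) :=
    Real.log_nonneg (one_le_mul_of_one_le_of_one_le (by linarith only [hL1r]) hN1r)
  have hW0 : 0 ≤ W := by rw [hW]; positivity
  -- the range of `e`
  set E₁ : ℕ := ⌊2 * L * N / (N : ℝ) ^ (δ j)⌋₊ with hE₁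
  have hE₁R : (E₁ : ℝ) ≤ 2 * L * N / (N : ℝ) ^ (δ j) := Nat.floor_le (by positivity)
  have hE₁le : E₁ ≤ 2 * L * N := by
    have h : (2 * L * N : ℝ) / (N : ℝ) ^ (δ j) ≤ ((2 * L * N : ℕ) : ℝ) := by
      rw [div_le_iff₀ hRj0]; push_cast
      calc (2 * L * N : ℝ) = 2 * L * N * 1 := by ring
        _ ≤ 2 * L * N * (N : ℝ) ^ (δ j) := by gcongr
    calc E₁ ≤ ⌊((2 * L * N : ℕ) : ℝ)⌋₊ := Nat.floor_le_floor h
      _ = 2 * L * N := Nat.floor_natCast _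
  -- Step 1: classes with `R_j e > 2LN` are empty
  have hstep1 : ∑ e ∈ Finset.Icc 1 (2 * L * N), ∑ d ∈ Fintype.piFinset T,
      |termClassSum Ψ K N ((N : ℝ) ^ (δ j)) j d e| =
      ∑ e ∈ Finset.Icc 1 E₁, ∑ d ∈ Fintype.piFinset T, |termClassSum Ψ K N ((N : ℝ) ^ (δ j)) j d e| := by
    symm
    refine Finset.sum_subset (Finset.Icc_subset_Icc le_rfl hE₁le) fun e he hne => ?_
    have he1 : 1 ≤ e := (Finset.mem_Icc.mp he).1
    have hE₁e : E₁ < e := by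
      by_contra h
      exact hne (Finset.mem_Icc.mpr ⟨he1, not_lt.mp h⟩)
    have hlt : (2 * L * N : ℝ) / (N : ℝ) ^ (δ j) < e :=
      calc (2 * L * N : ℝ) / (N : ℝ) ^ (δ j) < (E₁ : ℝ) + 1 := by rw [hE₁]; exact Nat.lt_floor_add_one _
        _ ≤ e := by exact_mod_cast hE₁e
    rw [div_lt_iff₀ hRj0] at hlt
    refine Finset.sum_eq_zero fun d _ => ?_
    rw [tcs_termClassSum_eq_zero Ψ K hN1 hsize _ j d (by linarith only [hlt]), abs_zero]
  -- Step 2: one class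
  have hclass : ∀ e ∈ Finset.Icc 1 E₁, ∀ d ∈ Fintype.piFinset T,
      |termClassSum Ψ K N ((N : ℝ) ^ (δ j)) j d e| ≤ W * (2 * N / (M (e, d) : ℝ) + 1) := by
    intro e he d hd
    obtain ⟨he1, heE⟩ := Finset.mem_Icc.mp he
    have heR : (N : ℝ) ^ (δ j) * e ≤ 2 * L * N := by
      have h1 : (e : ℝ) ≤ E₁ := by exact_mod_cast heE
      rw [le_div_iff₀ hRj0] at hE₁R
      calc (N : ℝ) ^ (δ j) * e ≤ (N : ℝ) ^ (δ j) * E₁ := by gcongr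
        _ = E₁ * (N : ℝ) ^ (δ j) := mul_comm _ _
        _ ≤ 2 * L * N := hE₁R
    have hdmem : ∀ i ∈ Finset.Ioi j, d i ∈ Finset.Icc 1 ⌊(N : ℝ) ^ (δ i)⌋₊ := fun i hi => by
      have h := Fintype.mem_piFinset.mp hd i
      simp only [hT, if_pos hi] at h
      exact h
    have hd1 : ∀ i ∈ Finset.Ioi j, 1 ≤ d i := fun i hi => (Finset.mem_Icc.mp (hdmem i hi)).1
    have hdle : ∀ i ∈ Finset.Ioi j, (d i : ℝ) ≤ (N : ℝ) ^ (δ i) := fun i hi =>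
      le_trans (by exact_mod_cast (Finset.mem_Icc.mp (hdmem i hi)).2) (Nat.floor_le (by positivity))
    have hD : ∏ i ∈ Finset.Ioi j, (d i : ℝ) ≤ (N : ℝ) ^ σ := by
      rw [hσ]
      exact tcs_prod_le_rpow_sum j δ hN1 (fun i => (d i : ℝ)) (fun i _ => Nat.cast_nonneg _) hdle
    have h := tcs_perClass k j η₁ C A θ σ L (4 * L ^ 2) Y₀ N δ Ψ K d e (Q (e, d)) hj hΨ hsize hK hKN
      hδ hσ hθ hθ0 hη₁0 hη₁1 hση hC0 hθC hA0 rfl hY₀ h2 h3 h4' h5 h6 he1 heR hd1 hD (hQ (e, d))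
    rw [← hM (e, d), ← hS, ← hW] at h
    exact h
  -- Step 3: the moduli (`∑ 1/M₀`) and the number of classes
  set SS : Finset (ℕ × (Fin (k + 1) → ℕ)) := Finset.Icc 1 E₁ ×ˢ Fintype.piFinset T with hSS
  set Z : ℕ := 2 * L * N * ∏ i ∈ Finset.Ioi j, B i with hZ
  have hB1 : ∀ i, 0 < B i := fun i => by
    rw [hB]
    exact Nat.le_floor (by rw [Nat.cast_one]; exact Real.one_le_rpow hN1r (hδ i).le)
  have hPB : 0 < ∏ i ∈ Finset.Ioi j, B i := Finset.prod_pos fun i _ => hB1 i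
  have hZ1 : 1 ≤ Z := Nat.succ_le_of_lt (Nat.mul_pos (Nat.mul_pos (by omega) (by omega)) hPB)
  have hMSS : ∀ p ∈ SS, 1 ≤ M p ∧ M p ≤ Z := by
    intro p hp
    rw [hSS, Finset.mem_product, Finset.mem_Icc, Fintype.mem_piFinset] at hp
    obtain ⟨⟨hp1, hpE⟩, hp2⟩ := hp
    have hq1 : ∀ i, 1 ≤ Q p i := fun i => by
      rw [hQ]
      split_ifs with hi1 hi2
      · have h := hp2 i; simp only [hT, if_pos hi1] at h; exact (Finset.mem_Icc.mp h).1
      · exact hp1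
      · exact le_rfl
    constructor
    · rw [hM]; exact one_le_lcm_div_gcd (fun i => (Ψ i).coeff 0) hq1
    · have hdvd := lcm_div_gcd_dvd_prod (fun i => (Ψ i).coeff 0) (Q p)
      rw [← hM, tcs_prod_moduli j p.2 (Q p) p.1 (hQ p)] at hdvd
      have hpos : 0 < p.1 * ∏ i ∈ Finset.Ioi j, p.2 i :=
        Nat.mul_pos (by omega) (Finset.prod_pos fun i hi => by
          have h := hq1 i; rw [hQ, if_pos hi] at h; exact h)
      refine (Nat.le_of_dvd hpos hdvd).trans ?_
      rw [hZ]
      refine Nat.mul_le_mul (hpE.trans hE₁le) (Finset.prod_le_prod (fun _ _ => Nat.zero_le _) ?_)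
      intro i hi
      have h := hp2 i; simp only [hT, if_pos hi] at h; exact (Finset.mem_Icc.mp h).2
  have hinv : ∑ p ∈ SS, (1 : ℝ) / M p ≤ 2 * (L : ℝ) ^ (k + 2) * (1 + Real.log Z) ^ (2 ^ (k + 2)) := by
    refine sum_inv_moduli_le SS M (by positivity) hMSS fun n hn => ?_
    have h := tcs_count_multiples j hΨ hN1 hsize E₁ B Q hQ hn
    simp only [← hM] at h
    rw [hSS]
    exact h
  have hcard : ((SS.card : ℕ) : ℝ) ≤ (E₁ : ℝ) * ∏ i ∈ Finset.Ioi j, (B i : ℝ) := by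
    rw [hSS]; exact tcs_card_pairs_le j E₁ B
  have hPBr : ∏ i ∈ Finset.Ioi j, (B i : ℝ) ≤ (N : ℝ) ^ σ := by
    rw [hσ]
    exact tcs_prod_le_rpow_sum j δ hN1 (fun i => (B i : ℝ)) (fun i _ => Nat.cast_nonneg _)
      fun i _ => Nat.floor_le (by positivity)
  have hcard' : ((SS.card : ℕ) : ℝ) ≤ 2 * L * (N : ℝ) ^ (1 - θ) := by
    have h1 : (E₁ : ℝ) * ∏ i ∈ Finset.Ioi j, (B i : ℝ) ≤
        (2 * L * N / (N : ℝ) ^ (δ j)) * (N : ℝ) ^ σ :=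
      mul_le_mul hE₁R hPBr (Finset.prod_nonneg fun i _ => Nat.cast_nonneg _) (by positivity)
    have h2 : (2 * L * N / (N : ℝ) ^ (δ j)) * (N : ℝ) ^ σ = 2 * L * (N : ℝ) ^ (1 - θ) := by
      rw [hθ, show 1 - (δ j - σ) = (1 + σ) - δ j by ring, Real.rpow_sub hN0, Real.rpow_add hN0,
        Real.rpow_one]
      ring
    linarith only [hcard, h1, h2.le]
  have hlogZ : (1 + Real.log Z) ^ m ≤ (1 + Real.log (2 * L * N * N)) ^ m := by
    have hZ0 : 0 ≤ 1 + Real.log Z := by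
      have := Real.log_nonneg (show (1 : ℝ) ≤ Z by exact_mod_cast hZ1); linarith only [this]
    refine pow_le_pow_left₀ hZ0 ?_ m
    have hZle : (Z : ℝ) ≤ 2 * L * N * N := by
      rw [hZ]; push_cast
      refine mul_le_mul_of_nonneg_left (hPBr.trans ?_) (by positivity)
      calc (N : ℝ) ^ σ ≤ (N : ℝ) ^ (1 : ℝ) := Real.rpow_le_rpow_of_exponent_le hN1r hσ1
        _ = N := Real.rpow_one _
    have := Real.log_le_log (by exact_mod_cast hZ1) hZle
    linarith only [this]
  -- Step 4: summing the classes
  have hsum : ∑ e ∈ Finset.Icc 1 E₁, ∑ d ∈ Fintype.piFinset T,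
      |termClassSum Ψ K N ((N : ℝ) ^ (δ j)) j d e| ≤
      W * (2 * N * (2 * (L : ℝ) ^ (k + 2) * (1 + Real.log (2 * L * N * N)) ^ m) +
        2 * L * (N : ℝ) ^ (1 - θ)) := by
    calc ∑ e ∈ Finset.Icc 1 E₁, ∑ d ∈ Fintype.piFinset T, |termClassSum Ψ K N ((N : ℝ) ^ (δ j)) j d e|
        ≤ ∑ e ∈ Finset.Icc 1 E₁, ∑ d ∈ Fintype.piFinset T, W * (2 * N / (M (e, d) : ℝ) + 1) :=
          Finset.sum_le_sum fun e he => Finset.sum_le_sum fun d hd => hclass e he d hd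
      _ = ∑ p ∈ SS, W * (2 * N / (M p : ℝ) + 1) := by
          rw [hSS, Finset.sum_product]
      _ = W * (2 * N * ∑ p ∈ SS, (1 : ℝ) / M p + ((SS.card : ℕ) : ℝ)) := by
          rw [← Finset.mul_sum, Finset.sum_add_distrib, Finset.sum_const, nsmul_eq_mul, mul_one,
            Finset.mul_sum]
          congr 1; congr 1
          exact Finset.sum_congr rfl fun p _ => by ring
      _ ≤ W * (2 * N * (2 * (L : ℝ) ^ (k + 2) * (1 + Real.log Z) ^ (2 ^ (k + 2))) +
            2 * L * (N : ℝ) ^ (1 - θ)) := by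
          refine mul_le_mul_of_nonneg_left (add_le_add ?_ hcard') hW0
          exact mul_le_mul_of_nonneg_left hinv (by positivity)
      _ ≤ W * (2 * N * (2 * (L : ℝ) ^ (k + 2) * (1 + Real.log (2 * L * N * N)) ^ m) +
            2 * L * (N : ℝ) ^ (1 - θ)) := by
          rw [← hm]
          refine mul_le_mul_of_nonneg_left ?_ hW0
          refine add_le_add (mul_le_mul_of_nonneg_left ?_ (by positivity)) le_rfl
          exact mul_le_mul_of_nonneg_left hlogZ (by positivity)
  -- Step 5: the closing estimate
  have hWT : W = 2 * Real.log (2 * L * N) *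
      ((2 * (c * Real.log N) ^ s + 1) / (θ / 2 * Real.log N) ^ (k + s + m + 2)) := by
    rw [hW, hS, hA, Real.rpow_natCast, hc, hs]
    congr 3
    ring
  rw [hstep1]
  calc Real.log N ^ k * ∑ e ∈ Finset.Icc 1 E₁, ∑ d ∈ Fintype.piFinset T,
        |termClassSum Ψ K N ((N : ℝ) ^ (δ j)) j d e|
      ≤ Real.log N ^ k * (W * (2 * N * (2 * (L : ℝ) ^ (k + 2) * (1 + Real.log (2 * L * N * N)) ^ m) +
          2 * L * (N : ℝ) ^ (1 - θ))) := mul_le_mul_of_nonneg_left hsum (pow_nonneg hlogN.le k)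
    _ = Real.log N ^ k * (2 * Real.log (2 * L * N) *
          ((2 * (c * Real.log N) ^ s + 1) / (θ / 2 * Real.log N) ^ (k + s + m + 2))) *
          (2 * N * (2 * (L : ℝ) ^ (k + 2) * (1 + Real.log (2 * L * N * N)) ^ m) +
            2 * L * (N : ℝ) ^ (1 - θ)) := by rw [hWT]; ring
    _ ≤ ε * N := h1

end Summit.Parity.GeneralizedHardyLittlewood.Cruxes.RelativeDimOne.SingleMoebiusSplit
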